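import Literature.IUT.LogThetaLattice.MultiradialityRemarks
import Mathlib.GroupTheory.QuotientGroup.Basic

/-!
# [IUTchIII] Rmk 2.1.2 (ii): `N_{Π̂}(Π†)/Π† ≅ Ẑ/ℤ` for the partially tempered group `Π† := Π̂ ×_{Ẑ} ℤ` — PROVED

S. Mochizuki, *Inter-universal Teichmüller theory III*, kurims manuscript, §2, Remark 2.1.2 (ii), p. 64 l. 22 –
p. 65 l. 5 ([IUTchIII] Rmk 2.1.2 (ii), kurims pp.64–65) [claim: Mochizuki2012, status: disputed] (D-0012 claim key;
series status DISPUTED — elementary group theory only; nothing of the series is asserted).  PROOF-ONLY companion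
(abc-iut cell; DAG node `IUTchIII:Rmk2.1.2(ii)`; seat abc-iut-L6-t19 gen 5) of `MultiradialityRemarks.lean`
(abc-iut-L6-t4, p404443: the named `Prop` `MultiradialityRemarks.Rmk212ii_normalizerQuotient Π† (Ẑ/ℤ) :=
Nonempty (N_{Π̂}(Π†)/Π† ≃* Ẑ/ℤ)`).  No definitions; the landed module is not edited.

PRINT (p. 64): with "the surjections `Π ↠ l·ℤ`, `Π̂ ↠ l·Ẑ`" and "`Π† := Π̂ ×_{Ẑ} ℤ ⊆ Π̂`" — "the [easily
verified] natural isomorphism `N_{Π̂}(Π†)/Π† ⥲ Ẑ/ℤ`".  THE VERIFICATION, as group theory over an arbitrary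
surjection `f : Π̂ ↠ A` onto an ABELIAN group (print: `A = l·Ẑ ≅ Ẑ`) and a subgroup `Z ≤ A` (print: `l·ℤ`), with
`Π† := f⁻¹(Z)`:

* `comap_normal_of_commGroup` — `Π†` is NORMAL in `Π̂` (every subgroup of the abelian `A` is normal and preimages
  of normal subgroups are normal), so `normalizer_comap_eq_top : N_{Π̂}(Π†) = Π̂`;
* `normalizerQuotientEquiv` is not a definition but an inhabitant produced inside the proof of
  **`rmk212ii_normalizerQuotient_of_surjective : Rmk212ii_normalizerQuotient (Z.comap f) (A ⧸ Z)`** — abc-iut-L6-t4's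
  decl BY NAME: `N_{Π̂}(Π†)/Π† ≃* A/Z` by the first isomorphism theorem for the surjection
  `N_{Π̂}(Π†) = Π̂ ↠ A ↠ A/Z`, whose kernel is `Π†`.

Nothing else of Rmk. 2.1.2 (ii) (the "no" answer, the `Ẑ`-translation indeterminacies on evaluation points) is a
claim with typed content.  Nothing here takes a side on [IUTchIII] Cor. 3.12; typed ≠ discharged.
-/

namespace Literature.IUT.LogThetaLattice.MultiradialityRemarks

universe u

variable {PiHat : Type u} [Group PiHat] {A : Type u} [CommGroup A]

/-- The preimage `Π† = f⁻¹(Z)` of a subgroup of an ABELIAN group under a homomorphism `f : Π̂ → A` is normal in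
`Π̂`. ([IUTchIII] Rmk 2.1.2 (ii) p.64) [claim: Mochizuki2012, status: disputed] -/
theorem comap_normal_of_commGroup (f : PiHat →* A) (Z : Subgroup A) : (Z.comap f).Normal :=
  inferInstance

/-- Hence `N_{Π̂}(Π†) = Π̂` for `Π† = f⁻¹(Z)`, `f : Π̂ → A` with `A` abelian. ([IUTchIII] Rmk 2.1.2 (ii) p.64)
[claim: Mochizuki2012, status: disputed] -/
theorem normalizer_comap_eq_top (f : PiHat →* A) (Z : Subgroup A) :
    Subgroup.normalizer ((Z.comap f : Subgroup PiHat) : Set PiHat) = ⊤ :=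
  haveI := comap_normal_of_commGroup f Z
  Subgroup.normalizer_eq_top (Z.comap f)

/-- **IUTchIII:Rmk2.1.2(ii)** (kurims p. 64 "the [easily verified] natural isomorphism `N_{Π̂}(Π†)/Π† ⥲ Ẑ/ℤ`"),
PROVED in the generality the verification uses: for a SURJECTIVE homomorphism `f : Π̂ ↠ A` onto an abelian group
(print: `Π̂ ↠ l·Ẑ`) and a subgroup `Z ≤ A` (print: `l·ℤ ⊆ l·Ẑ`), the partially tempered group `Π† := f⁻¹(Z)`
satisfies abc-iut-L6-t4's `Rmk212ii_normalizerQuotient Π† (A ⧸ Z)`: `N_{Π̂}(Π†)/Π† ≃* A/Z` (the normaliser is all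
of `Π̂`, and `Π̂ ↠ A ↠ A/Z` has kernel `Π†`).  PROVED. ([IUTchIII] Rmk 2.1.2 (ii) p.64) [claim: Mochizuki2012, status: disputed] -/
theorem rmk212ii_normalizerQuotient_of_surjective (f : PiHat →* A) (hf : Function.Surjective f)
    (Z : Subgroup A) : Rmk212ii_normalizerQuotient (Z.comap f) (A ⧸ Z) := by
  set N := Subgroup.normalizer ((Z.comap f : Subgroup PiHat) : Set PiHat) with hN
  have hNtop : N = ⊤ := normalizer_comap_eq_top f Z
  -- the surjection `N = Π̂ ↠ A ↠ A/Z`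
  let φ : N →* A ⧸ Z := (QuotientGroup.mk' Z).comp (f.comp N.subtype)
  have hφ : Function.Surjective φ := by
    intro q
    induction q using QuotientGroup.induction_on with
    | H a =>
      obtain ⟨x, rfl⟩ := hf a
      exact ⟨⟨x, by rw [hNtop]; exact Subgroup.mem_top x⟩, rfl⟩
  -- its kernel is `Π†`
  have hker : φ.ker = (Z.comap f).subgroupOf N := by
    ext x
    rw [MonoidHom.mem_ker, Subgroup.mem_subgroupOf, Subgroup.mem_comap]
    exact QuotientGroup.eq_one_iff (x := f x)
  exact ⟨(QuotientGroup.quotientMulEquivOfEq hker).symm.trans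
    (QuotientGroup.quotientKerEquivOfSurjective φ hφ)⟩

end Literature.IUT.LogThetaLattice.MultiradialityRemarks
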